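import Literature.NumberTheory.GaloisRepresentations.LocalCFTFromReciprocitySystem
import Literature.NumberTheory.GaloisRepresentations.LocalReciprocityNormFunctoriality
import Literature.NumberTheory.GaloisRepresentations.LocalExistenceReciprocity
import HarnessLib

/-!
# Local class field theory: the reciprocity law, the existence theorem and Serre's norm-group
facts DISCHARGED (Serre, *Local Fields*, XIII §4 and XIV §6; XI §4–§5)

Topic `NumberTheory/GaloisRepresentations`, namespace `Literature.NumberTheory.GaloisRepresentations`.
Theorems only (no definition, no new named fact).  Eight named facts of the tree, all stated for a
non-archimedean local field `F` (`[Field F] [ValuativeRel F] [TopologicalSpace F]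
[IsNonarchimedeanLocalField F]`) in `LocalExistenceReciprocity.lean`, `LocalExistenceTheorem.lean` and
`LocalClassFieldTheory.lean`, are proved here by assembling theorems the tree already has:

* `localReciprocityLaw_holds` — **the local reciprocity law at finite level** (Serre XIII §4, Cor. to
  Prop. 8 and Prop. 12: the norm residue symbols `θ_E : Fˣ →* Gal(E/F)`, surjective with kernel
  `N_{E/F}(Eˣ)`, compatible in towers), from the reciprocity SYSTEM of `F`
  (`LocalWeilDatum.exists_isReciprocitySystem_holds`, Neukirch's cohomology-free route, Neukirch ANT V
  (1.3)) through the bridge `localReciprocityLaw_of_exists_isReciprocitySystem`;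
* `index_normSubgroup_eq_finrank_holds` — **the fundamental equality** `[Fˣ : N_{E/F}(Eˣ)] = [E : F]`
  for finite abelian `E/F` (Serre XIII §4 Prop. 9; XI §4 Cor. to Prop. 3);
* `isNormSubgroup_inf_holds`, `isNormSubgroup_of_le_holds` — **norm groups are stable under
  intersection, and every subgroup containing a norm group is a norm group** (Serre XI §4 Prop. 4);
* `isNormSubgroup_of_unitGroup_le_holds` — **axiom III-3 of Serre's existence proof**: every closed
  finite-index subgroup of `Fˣ` containing the units is a norm group (Serre XIV §6, proof of Thm. 1;
  the `v⁻¹(nℤ)` are the norm groups of the unramified extensions);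
* `localExistenceTheorem_holds` and (the same statement under its trunk name)
  `exists_intermediateField_normSubgroup_eq_holds` — **the existence theorem** (Serre XIV §6 Thm. 1:
  every open subgroup of finite index of `Fˣ` is a norm group `N_{E/F}(Eˣ)` of a finite abelian `E/F`),
  through `localExistenceTheorem_of_exists_isReciprocitySystem` (Cassels–Fröhlich VI §3.8 with the
  Lubin–Tate norm groups, `LubinTateNormGroup.lean`);
* `universalNormSubgroup_divisible_and_eq_holds` — **Serre XI §5 Prop. 6** («the group `D_E` of
  universal norms is divisible and equal to `⋂ₙ n·A_E`») for the class formation of a local field: both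
  sides are trivial — `D_F = 1` is the tree's `universalNormSubgroup_eq_bot` (Serre XIV §6 Cor. 2 (i),
  proved there via Lubin–Tate), and `⋂ₙ (Fˣ)ⁿ = 1` (`iInf_range_powMonoidHom_eq_bot`, proved here:
  `(Fˣ)^{[E:F]} ≤ N_{E/F}(Eˣ)` by the fundamental equality, so `⋂ₙ (Fˣ)ⁿ ≤ D_F`).

Consumers in the tree that took these facts as hypotheses `(h : …)` can now be fed the `_holds`
theorems, e.g. `index_quadraticNormSubgroup_eq_two_of_index_normSubgroup_eq_finrank`,
`adicCompletion_exists_hilbertSymbol_eq_neg_one_of_index_normSubgroup_eq_finrank`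
(`QuadraticForms/QuadraticNormLocalCFT.lean`),
`nonempty_algEquiv_of_ramifiedPlaces_eq_of_index_normSubgroup_eq_finrank`
(`Automorphic/QuaternionAlgebraLocalUniqueness.lean`), `isNormSubgroup_of_higherUnitGroup_one_le`,
`isNormSubgroup_of_principalUnitGroup_le` (`LocalExistenceTameProofs.lean`), `IsNormSubgroup.finiteIndex`,
`universalNormSubgroup_le_of_finiteIndex` (`LocalExistenceTheorem.lean`).

## References
* J.-P. Serre, *Local Fields*, GTM 67, Springer 1979: Ch. XI §4 Prop. 3 Cor., Prop. 4, §5 Prop. 6;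
  Ch. XIII §4 Thm. 1, Prop. 8 Cor., Prop. 9, Prop. 12; Ch. XIV §6 Thm. 1, Cor. 1, Cor. 2.
  [SerreLocalFields1979]
* J. Neukirch, *Algebraic Number Theory*, Grundlehren 322, Springer 1999, Ch. IV §6 (6.3), Ch. V §1
  Thm. (1.3), (1.4). [NeukirchANT1999]
-/

namespace Literature.NumberTheory.GaloisRepresentations

universe u

variable (F : Type u) [Field F] [ValuativeRel F] [TopologicalSpace F] [IsNonarchimedeanLocalField F]

/-! ### The reciprocity law and its consequences (Serre XIII §4, XI §4) -/

/-- **The local reciprocity law (finite abelian extensions) HOLDS**: for a non-archimedean local field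
`F` there is a family of norm residue symbols `θ_E : Fˣ →* Gal(E/F)`, surjective with kernel
`N_{E/F}(Eˣ)` for finite abelian `E/F` and compatible in towers — the first three clauses of the
reciprocity system `LocalWeilDatum.exists_isReciprocitySystem_holds` (Neukirch's route).
[cite: SerreLocalFields1979, Ch. XIII §4 Cor. to Prop. 8 and Prop. 12]
[cite: NeukirchANT1999, Ch. V §1, Thm. (1.3)] -/
theorem localReciprocityLaw_holds : localReciprocityLaw F :=
  localReciprocityLaw_of_exists_isReciprocitySystem (LocalWeilDatum.exists_isReciprocitySystem_holds F)

/-- **The fundamental equality HOLDS**: `[Fˣ : N_{E/F}(Eˣ)] = [E : F]` for every finite abelian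
extension `E/F` (inside `F̄`) of a non-archimedean local field `F`.
[cite: SerreLocalFields1979, Ch. XIII §4 Prop. 9] -/
theorem index_normSubgroup_eq_finrank_holds : index_normSubgroup_eq_finrank F :=
  index_normSubgroup_eq_finrank_of_reciprocity (localReciprocityLaw_holds F)

/-- **Norm groups are stable under intersection (HOLDS)**: the intersection of two norm groups of `Fˣ`
is a norm group (Serre XI §4 Prop. 4, `I_{F·F'} = I_F ∩ I_{F'}`).
[cite: SerreLocalFields1979, Ch. XI §4 Prop. 4] -/
theorem isNormSubgroup_inf_holds : isNormSubgroup_inf F :=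
  isNormSubgroup_inf_of_reciprocity (localReciprocityLaw_holds F)

/-- **Every subgroup of `Fˣ` containing a norm group is a norm group (HOLDS)** (Serre XI §4 Prop. 4,
last assertion). [cite: SerreLocalFields1979, Ch. XI §4 Prop. 4] -/
theorem isNormSubgroup_of_le_holds : isNormSubgroup_of_le F :=
  isNormSubgroup_of_le_of_reciprocity (localReciprocityLaw_holds F)

/-- **Axiom III-3 of Serre's existence proof HOLDS as printed**: every closed subgroup of finite index
of `Fˣ` containing the unit group `U_F` is a norm group — these are the `v⁻¹(nℤ)`, norm groups of the
unramified extensions of degree `n` (Serre XIV §6, proof of Thm. 1, III-3; XIII §4 Prop. 13) — from the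
reciprocity law through `isNormSubgroup_of_unitGroup_le_of_reciprocity` (the proved weak form
`exists_isNormSubgroup_le_of_unitGroup_le` plus `isNormSubgroup_of_le`).
[cite: SerreLocalFields1979, Ch. XIV §6 Thm. 1 (proof, axiom III-3)] -/
theorem isNormSubgroup_of_unitGroup_le_holds : isNormSubgroup_of_unitGroup_le F :=
  isNormSubgroup_of_unitGroup_le_of_reciprocity (localReciprocityLaw_holds F)

/-! ### The existence theorem (Serre XIV §6 Thm. 1) -/

/-- **The existence theorem of local class field theory HOLDS**: every open subgroup of finite index
of `Fˣ`, `F` a non-archimedean local field, is the norm group `N_{E/F}(Eˣ)` of a finite abelian Galois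
extension `E/F` inside `F̄` — from the reciprocity system of `F` and the Lubin–Tate norm groups
(`localExistenceTheorem_of_exists_isReciprocitySystem`).
[cite: SerreLocalFields1979, Ch. XIV §6 Thm. 1] -/
theorem localExistenceTheorem_holds : localExistenceTheorem F :=
  localExistenceTheorem_of_exists_isReciprocitySystem F
    (LocalWeilDatum.exists_isReciprocitySystem_holds F)

/-- **The trunk fact `exists_intermediateField_normSubgroup_eq F` HOLDS** for every non-archimedean
local field `F` (the same statement as `localExistenceTheorem F`, Serre XIV §6 Thm. 1, under the
name vendored in `LocalClassFieldTheory.lean`). [cite: SerreLocalFields1979, Ch. XIV §6 Thm. 1] -/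
theorem exists_intermediateField_normSubgroup_eq_holds : exists_intermediateField_normSubgroup_eq F :=
  exists_intermediateField_normSubgroup_eq_of_exists_isReciprocitySystem F
    (LocalWeilDatum.exists_isReciprocitySystem_holds F)

/-! ### Universal norms and infinitely divisible elements (Serre XI §5 Prop. 6, XIV §6 Cor. 2) -/

/-- In a commutative group the `[G : H]`-th powers lie in `H` (Lagrange in `G/H`; for `H` of infinite
index `[G : H] = 0` and the statement is trivial). [folklore] -/
private theorem range_powMonoidHom_index_le {G : Type*} [CommGroup G] (H : Subgroup G) :
    (powMonoidHom H.index : G →* G).range ≤ H := by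
  rintro _ ⟨g, rfl⟩
  exact H.pow_index_mem g

/-- **Every norm group contains `⋂ₙ (Fˣ)ⁿ`**: for `U = N_{E/F}(Eˣ)`, `E/F` finite abelian, the
fundamental equality gives `[Fˣ : U] = [E : F] ≥ 1`, so `(Fˣ)^{[E:F]} ≤ U`.
[cite: SerreLocalFields1979, Ch. XIII §4 Prop. 9] -/
theorem iInf_range_powMonoidHom_le_of_isNormSubgroup {U : Subgroup Fˣ} (hU : IsNormSubgroup F U) :
    (⨅ (n : ℕ) (_ : 0 < n), (powMonoidHom n : Fˣ →* Fˣ).range) ≤ U := by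
  obtain ⟨E, hE, hEab, rfl⟩ := hU
  haveI : FiniteDimensional F E := hE
  have hidx : (Units.map (Algebra.norm F : E →* F)).range.index = Module.finrank F E :=
    index_normSubgroup_eq_finrank_holds F E hE hEab
  have hpos : 0 < (Units.map (Algebra.norm F : E →* F)).range.index := by
    rw [hidx]
    exact Module.finrank_pos
  exact (iInf₂_le (Units.map (Algebra.norm F : E →* F)).range.index hpos).trans
    (range_powMonoidHom_index_le _)

/-- **`⋂ₙ (Fˣ)ⁿ ≤ D_F`**: an element of `Fˣ` which is an `n`-th power for every `n ≥ 1` is a universal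
norm (it lies in every norm group, `iInf_range_powMonoidHom_le_of_isNormSubgroup`) — the inclusion
`⋂ n·A_E ⊆ D_E` of Serre XI §5 Prop. 6 for the class formation of a local field.
[cite: SerreLocalFields1979, Ch. XI §5 Prop. 6] -/
theorem iInf_range_powMonoidHom_le_universalNormSubgroup :
    (⨅ (n : ℕ) (_ : 0 < n), (powMonoidHom n : Fˣ →* Fˣ).range) ≤ universalNormSubgroup F := by
  unfold universalNormSubgroup
  exact le_iInf₂ fun U hU => iInf_range_powMonoidHom_le_of_isNormSubgroup F hU

/-- **A non-archimedean local field has no infinitely divisible elements other than `1`**: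
`⋂_{n ≥ 1} (Fˣ)ⁿ = 1` (Serre XIV §6 Cor. 2 (i) with XI §5 Prop. 6: `⋂ₙ (Fˣ)ⁿ ⊆ D_F = 1`).
[cite: SerreLocalFields1979, Ch. XIV §6 Cor. 2 (i)] -/
theorem iInf_range_powMonoidHom_eq_bot :
    (⨅ (n : ℕ) (_ : 0 < n), (powMonoidHom n : Fˣ →* Fˣ).range) = ⊥ :=
  le_bot_iff.mp ((iInf_range_powMonoidHom_le_universalNormSubgroup F).trans
    (universalNormSubgroup_eq_bot F).le)

/-- **Serre XI §5 Prop. 6 HOLDS for a non-archimedean local field**: the group of universal norms `D_F`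
is divisible and equals `⋂_{n ≥ 1} (Fˣ)ⁿ` — both being trivial (`universalNormSubgroup_eq_bot`,
Serre XIV §6 Cor. 2 (i), and `iInf_range_powMonoidHom_eq_bot`).
[cite: SerreLocalFields1979, Ch. XI §5 Prop. 6] [cite: SerreLocalFields1979, Ch. XIV §6 Cor. 2] -/
theorem universalNormSubgroup_divisible_and_eq_holds : universalNormSubgroup_divisible_and_eq F := by
  refine ⟨fun n _ x hx => ⟨1, Subgroup.one_mem _, ?_⟩, ?_⟩
  · rw [universalNormSubgroup_eq_bot F, Subgroup.mem_bot] at hx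
    rw [hx, one_pow]
  · rw [universalNormSubgroup_eq_bot F, iInf_range_powMonoidHom_eq_bot F]

end Literature.NumberTheory.GaloisRepresentations
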